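import Summits.Ventures.YMGap.Census.DecimationStrict
import HarnessLib

/-!
# Venture YMGap, track (b) — CONTINUITY of Tomboulis's `α_Λ(t, r)`, `α⁺_Λ(t, r)` in `t` and the CROSSING CRITERION for
# Ito–Seiler's Problem 2 (arXiv:0707.2179 §3.2 after (3.24), (5.14); arXiv:0803.3019 §3.2 Problem 2)

HONEST FRAMING: venture file of the cell `pub-ymgap` (QuantumFields programme), track (b) census.  Exact statements about ONE
decimation `(ℤ/bLℤ)^d → (ℤ/Lℤ)^d`, `d ≥ 3`, `b ≥ 2`, `L` even, on the positivity domain with a non-trivial action; NOTHING is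
asserted about whether the crossing hypotheses hold on any instance (that is the census computation C7 / TB-P2), about (5.15),
limits, confinement or a mass gap.

Tomboulis (after (3.24)): «by the implicit function theorem, applicable by III.3, there is a function `α_{Λ,h}^{(m)}(t,r)` with
continuous derivatives … this neighborhood can be extended by a standard continuity argument».  Ito–Seiler (arXiv:0803.3019 §3.2,
Problem 2): «The existence of `t*` satisfying `α⁺(t*) = α(t*)` is not established».  With existence AND uniqueness of `α_Λ(t,r)`,
`α⁺_Λ(t,r)` in the tree (`DecimationStrict.existsUnique_isAlpha`, `existsUnique_isAlphaPlus`) this file supplies the kernel form of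
the «continuity argument» the census rows for Problem 2 invoke (cell file `lit/LIT2-TOMBOULIS-ITOSEILER.md` §J.4 TB-P2: «a certified
sign change of `α⁺ − α` on the `t`-grid ⇒ a solution `t*` by continuity»):
* `continuousAt_root_of_strictMonoOn` — roots of a family strictly increasing in `α ∈ (0,1]` and continuous in `t` move continuously
  (elementary: strict monotonicity + continuity in `t` at two bracketing points; no derivatives, no implicit function theorem);
* `continuous_tildeZ_t`, `continuous_tildeZplus_t`; **`continuousAt_isAlpha_selection`** / **`continuousAt_isAlphaPlus_selection`** —
  ANY selection `t ↦ α(t)` of solutions of `IsAlpha d L b J r c t ·` (resp. `IsAlphaPlus …`) is continuous at every `t₀ > 0`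
  (`d ≥ 3`, `b ≥ 2`, `L` even, `0 ≤ r`, `f_c ≥ 0`, some `c_n > 0`; strictness from `DecimationNontrivial.tildeZ_strictMonoOn`);
* **`isProblem2_of_crossing`** / **`isProblem2_holds_of_crossing`** — THE CROSSING CRITERION: if at `t₁ > 0` some
  `a₁ ∈ (0,1]` has `Z_Λ ≤ Z̃(a₁,t₁)` and `Z̃⁺(a₁,t₁) ≤ Z⁺_Λ` (so `α_Λ(t₁) ≤ a₁ ≤ α⁺_Λ(t₁)`), and at `t₂ > 0` some `a₂ ∈ (0,1]`
  has `Z̃(a₂,t₂) ≤ Z_Λ` and `Z⁺_Λ ≤ Z̃⁺(a₂,t₂)` (so `α⁺_Λ(t₂) ≤ a₂ ≤ α_Λ(t₂)`), then there is `t*` between `t₁` and `t₂`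
  (`Set.uIcc`: either order, so both sign patterns are covered) with a COMMON solution `α_Λ(t*) = α⁺_Λ(t*)`, i.e.
  `Tomboulis2007.ISProblem2 L b J r i j hij c` holds — four finitely checkable inequalities between explicit numbers, the
  shape of a census certificate for IS08 Problem 2 at the first step.

References: E. T. Tomboulis, arXiv:0707.2179, §3.2 (3.23)–(3.24), §5 (5.14) [cite: Tomboulis2007Confinement, §3.2 eqs. (3.23)–(3.24)];
K. R. Ito, E. Seiler, arXiv:0711.4930 §3 (3.2) and arXiv:0803.3019 §3.2 Problem 2 [cite: ItoSeiler2007Tomboulis, §3 eq. (3.2)].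
-/

noncomputable section

open MeasureTheory Finset Real Function Filter Topology
open scoped BigOperators
open Literature.MathematicalPhysics.QuantumLattice
open Literature.MathematicalPhysics.QuantumFieldTheory
open Literature.MathematicalPhysics.QuantumFieldTheory.Tomboulis2007

namespace Summit.Ventures.YMGap.Census

variable {d L : ℕ}

/-! ### Continuity of `t ↦ α_Λ(t, r)`, `t ↦ α⁺_Λ(t, r)` and the crossing criterion for Ito–Seiler's Problem 2 -/

section Crossing

variable {b : ℕ} [NeZero b] [NeZero L]

omit [NeZero b] [NeZero L] in
/-- **Roots of a family that is strictly increasing in `α ∈ (0,1]` and continuous in `t` move continuously with `t`.**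
If `G(·, t)` is strictly increasing on `(0, 1]` for every `t > 0`, `G(α, ·)` is continuous at every `t > 0` for every
`α ∈ (0, 1]`, and `a(t) ∈ (0, 1)` solves `G(a(t), t) = y` for every `t > 0`, then `a` is continuous at every `t₀ > 0`. -/
theorem continuousAt_root_of_strictMonoOn {G : ℝ → ℝ → ℝ} {y : ℝ} {a : ℝ → ℝ}
    (hmono : ∀ t, 0 < t → StrictMonoOn (fun α => G α t) (Set.Ioc 0 1))
    (hcont : ∀ α, α ∈ Set.Ioc (0 : ℝ) 1 → ∀ t, 0 < t → ContinuousAt (fun s => G α s) t)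
    (ha : ∀ t, 0 < t → a t ∈ Set.Ioo (0 : ℝ) 1 ∧ G (a t) t = y) {t₀ : ℝ} (ht₀ : 0 < t₀) : ContinuousAt a t₀ := by
  rw [Metric.continuousAt_iff]
  intro ε hε
  obtain ⟨⟨ha0, ha1⟩, haeq⟩ := ha t₀ ht₀
  -- a margin `η ≤ ε` keeping `a t₀ ± η` inside `(0, 1)`
  set η : ℝ := min ε (min (a t₀) (1 - a t₀)) / 2 with hη
  have hηpos : 0 < η := by
    have : 0 < min ε (min (a t₀) (1 - a t₀)) := lt_min hε (lt_min ha0 (by linarith))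
    rw [hη]; linarith
  have hηε : η < ε := by
    have : min ε (min (a t₀) (1 - a t₀)) ≤ ε := min_le_left _ _
    rw [hη]; linarith
  have hηa : η < a t₀ := by
    have : min ε (min (a t₀) (1 - a t₀)) ≤ a t₀ := (min_le_right _ _).trans (min_le_left _ _)
    rw [hη]; linarith
  have hη1 : a t₀ + η < 1 := by
    have : min ε (min (a t₀) (1 - a t₀)) ≤ 1 - a t₀ := (min_le_right _ _).trans (min_le_right _ _)
    rw [hη]; linarith
  have hlo : a t₀ - η ∈ Set.Ioc (0 : ℝ) 1 := ⟨by linarith, by linarith⟩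
  have hhi : a t₀ + η ∈ Set.Ioc (0 : ℝ) 1 := ⟨by linarith, hη1.le⟩
  have hmid : a t₀ ∈ Set.Ioc (0 : ℝ) 1 := ⟨ha0, ha1.le⟩
  -- at `t₀`: `G(a t₀ - η, t₀) < y < G(a t₀ + η, t₀)`
  have h1 : G (a t₀ - η) t₀ < y := by rw [← haeq]; exact hmono t₀ ht₀ hlo hmid (by linarith)
  have h2 : y < G (a t₀ + η) t₀ := by rw [← haeq]; exact hmono t₀ ht₀ hmid hhi (by linarith)
  -- by continuity in `t` the two strict inequalities persist near `t₀`
  have hev : ∀ᶠ t in nhds t₀, G (a t₀ - η) t < y ∧ y < G (a t₀ + η) t ∧ 0 < t := by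
    refine ((hcont _ hlo t₀ ht₀).eventually (gt_mem_nhds h1)).and
      (((hcont _ hhi t₀ ht₀).eventually (lt_mem_nhds h2)).and (lt_mem_nhds ht₀))
  obtain ⟨δ, hδ, hball⟩ := Metric.eventually_nhds_iff.1 hev
  refine ⟨δ, hδ, fun t ht => ?_⟩
  obtain ⟨hG1, hG2, htpos⟩ := hball ht
  obtain ⟨⟨hat0, hat1⟩, hateq⟩ := ha t htpos
  have hamem : a t ∈ Set.Ioc (0 : ℝ) 1 := ⟨hat0, hat1.le⟩
  -- monotonicity in `α` pins `a t` between `a t₀ - η` and `a t₀ + η`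
  have hlt1 : a t₀ - η < a t := by
    by_contra hle
    push Not at hle
    have := (hmono t htpos).monotoneOn hamem hlo hle
    linarith [hateq]
  have hlt2 : a t < a t₀ + η := by
    by_contra hle
    push Not at hle
    have := (hmono t htpos).monotoneOn hhi hamem hle
    linarith [hateq]
  rw [Real.dist_eq, abs_lt]
  constructor <;> linarith

omit [NeZero b] in
/-- `t ↦ Z̃(α, t)` is continuous (fixed `α ≠ 0`). -/
theorem continuous_tildeZ_t (J : ℕ) (r : ℝ) {c : ℕ → ℝ} (hc : ∀ n, 1 ≤ n → 0 ≤ c n) {α : ℝ} (hα : α ≠ 0) :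
    Continuous fun t => tildeZ d L b J r c α t := by
  unfold tildeZ
  have hF : mkF0 J c (b ^ (d - 2)) b ≠ 0 := (zero_lt_one.trans_le (one_le_mkF0 hc _ b)).ne'
  refine Continuous.mul ?_ continuous_const
  have hh : Continuous fun t => interpH α t := by
    simp only [interpH_eq _ hα]
    fun_prop
  exact continuous_iff_continuousAt.2 fun t =>
    (Real.continuousAt_const_rpow hF).comp ((hh.mul continuous_const).continuousAt)

omit [NeZero b] in
/-- `t ↦ Z̃⁺(α, t)` is continuous (fixed `α ≠ 0`). -/
theorem continuous_tildeZplus_t (J : ℕ) (r : ℝ) {i j : Fin d} (hij : i < j) {c : ℕ → ℝ} (hc : ∀ n, 1 ≤ n → 0 ≤ c n) {α : ℝ}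
    (hα : α ≠ 0) : Continuous fun t => tildeZplus L b J r i j hij c α t := by
  unfold tildeZplus
  have hF : mkF0 J c (b ^ (d - 2)) b ≠ 0 := (zero_lt_one.trans_le (one_le_mkF0 hc _ b)).ne'
  refine Continuous.mul ?_ continuous_const
  have hh : Continuous fun t => interpH α t := by
    simp only [interpH_eq _ hα]
    fun_prop
  exact continuous_iff_continuousAt.2 fun t =>
    (Real.continuousAt_const_rpow hF).comp ((hh.mul continuous_const).continuousAt)

/-- **`t ↦ α_Λ(t, r)` is continuous on `t > 0`** (arXiv:0707.2179 after (3.24): «by the implicit function theorem, applicable by III.3 …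
this neighborhood can be extended by a standard continuity argument»; here: strict monotonicity in `α` + continuity in `t`, no derivatives):
ANY selection `a(t)` of solutions of `IsAlpha d L b J r c t (a t)` is continuous at every `t₀ > 0`. -/
theorem continuousAt_isAlpha_selection (hd : 3 ≤ d) (hb : 2 ≤ b) (hL : Even L) (J : ℕ) {c : ℕ → ℝ} (hc : ∀ n, 1 ≤ n → 0 ≤ c n)
    (hf : ∀ g : SU2, 0 ≤ plaqFn J c g) {n₀ : ℕ} (hn₀ : n₀ ∈ Icc 1 J) (hpos : 0 < c n₀) {r : ℝ} (hr : 0 ≤ r) {a : ℝ → ℝ}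
    (ha : ∀ t, 0 < t → IsAlpha d L b J r c t (a t)) {t₀ : ℝ} (ht₀ : 0 < t₀) : ContinuousAt a t₀ :=
  continuousAt_root_of_strictMonoOn (G := fun α t => tildeZ d L b J r c α t) (y := torusZ d (b * L) J c)
    (fun _ ht => tildeZ_strictMonoOn hd hb hL J hc hf hn₀ hpos hr ht)
    (fun _ hα _ _ => (continuous_tildeZ_t (d := d) (L := L) (b := b) J r hc hα.1.ne').continuousAt) ha ht₀

/-- **`t ↦ α⁺_Λ(t, r)` is continuous on `t > 0`**: any selection of solutions of `IsAlphaPlus L b J r i j hij c t ·` is continuous. -/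
theorem continuousAt_isAlphaPlus_selection (hd : 3 ≤ d) (hb : 2 ≤ b) (hL : Even L) (J : ℕ) {i j : Fin d} (hij : i < j)
    {c : ℕ → ℝ} (hc : ∀ n, 1 ≤ n → 0 ≤ c n) (hf : ∀ g : SU2, 0 ≤ plaqFn J c g) {n₀ : ℕ} (hn₀ : n₀ ∈ Icc 1 J) (hpos : 0 < c n₀)
    {r : ℝ} (hr : 0 ≤ r) {a : ℝ → ℝ} (ha : ∀ t, 0 < t → IsAlphaPlus L b J r i j hij c t (a t)) {t₀ : ℝ} (ht₀ : 0 < t₀) :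
    ContinuousAt a t₀ :=
  continuousAt_root_of_strictMonoOn (G := fun α t => tildeZplus L b J r i j hij c α t)
    (y := torusZplus d (b * L) J c (vortexSheet (b * L) i j hij))
    (fun _ ht => tildeZplus_strictMonoOn hd hb hL J hij hc hf hn₀ hpos hr ht)
    (fun _ hα _ _ => (continuous_tildeZplus_t (d := d) (L := L) (b := b) J r hij hc hα.1.ne').continuousAt) ha ht₀

/-- **CROSSING CRITERION for Ito–Seiler's Problem 2 at the first step** (arXiv:0803.3019 §3.2 Problem 2 / arXiv:0707.2179 (5.14)):
if at some `t₁ > 0` a value `a₁ ∈ (0,1]` separates the two defining equations from one side — `Z_Λ ≤ Z̃(a₁, t₁)` (so `α_Λ(t₁) ≤ a₁`)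
and `Z̃⁺(a₁, t₁) ≤ Z⁺_Λ` (so `a₁ ≤ α⁺_Λ(t₁)`) — and at some `t₂ > 0` (on either side of `t₁`) a value `a₂` separates them from the
other side, then by continuity of `t ↦ α_Λ(t) - α⁺_Λ(t)` there is `t*` between `t₁` and `t₂` with a COMMON solution: `ISProblem2` holds
on this instance.  (The four hypotheses are finitely checkable inequalities between explicit numbers — the shape of a census
certificate.) -/
theorem isProblem2_of_crossing (hd : 3 ≤ d) (hb : 2 ≤ b) (hL : Even L) (J : ℕ) {i j : Fin d} (hij : i < j) {c : ℕ → ℝ}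
    (hc : CoeffAdmissible c) (hf : ∀ g : SU2, 0 ≤ plaqFn J c g) {n₀ : ℕ} (hn₀ : n₀ ∈ Icc 1 J) (hpos : 0 < c n₀) {r : ℝ}
    (hr0 : 0 ≤ r) (hr1 : r ≤ 1) {t₁ t₂ a₁ a₂ : ℝ} (ht₁ : 0 < t₁) (ht₂ : 0 < t₂) (ha₁ : a₁ ∈ Set.Ioc (0 : ℝ) 1)
    (ha₂ : a₂ ∈ Set.Ioc (0 : ℝ) 1)
    (h1Z : torusZ d (b * L) J c ≤ tildeZ d L b J r c a₁ t₁)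
    (h1P : tildeZplus L b J r i j hij c a₁ t₁ ≤ torusZplus d (b * L) J c (vortexSheet (b * L) i j hij))
    (h2Z : tildeZ d L b J r c a₂ t₂ ≤ torusZ d (b * L) J c)
    (h2P : torusZplus d (b * L) J c (vortexSheet (b * L) i j hij) ≤ tildeZplus L b J r i j hij c a₂ t₂) :
    ∃ t ∈ Set.uIcc t₁ t₂, ∃ α : ℝ, IsAlpha d L b J r c t α ∧ IsAlphaPlus L b J r i j hij c t α := by
  have hc' : ∀ n, 1 ≤ n → 0 ≤ c n := fun n hn => (hc n hn).1
  -- selections of the two (unique) solutions on `t > 0`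
  have hexA : ∀ t, 0 < t → ∃ α, IsAlpha d L b J r c t α := fun _ ht => exists_isAlpha hd hb hL J hc hf hn₀ hpos hr0 hr1 ht
  have hexP : ∀ t, 0 < t → ∃ α, IsAlphaPlus L b J r i j hij c t α := fun _ ht =>
    exists_isAlphaPlus hd hb hL hij J hc hf hn₀ hpos hr0 hr1 ht
  choose! aA haA using hexA
  choose! aP haP using hexP
  have hpos_t : ∀ t ∈ Set.uIcc t₁ t₂, 0 < t := fun t ht => by
    rcases Set.mem_uIcc.1 ht with h | h
    · exact ht₁.trans_le h.1
    · exact ht₂.trans_le h.1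
  have hmonoA := fun t (ht : 0 < t) => tildeZ_strictMonoOn (d := d) (L := L) (b := b) hd hb hL J hc' hf hn₀ hpos hr0 ht
  have hmonoP := fun t (ht : 0 < t) => tildeZplus_strictMonoOn (d := d) (L := L) (b := b) hd hb hL J hij hc' hf hn₀ hpos hr0 ht
  have hmemA : ∀ t, 0 < t → aA t ∈ Set.Ioc (0 : ℝ) 1 := fun t ht => ⟨(haA t ht).1.1, (haA t ht).1.2.le⟩
  have hmemP : ∀ t, 0 < t → aP t ∈ Set.Ioc (0 : ℝ) 1 := fun t ht => ⟨(haP t ht).1.1, (haP t ht).1.2.le⟩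
  -- at `t₁`: `aA t₁ ≤ a₁ ≤ aP t₁`
  have hA1 : aA t₁ ≤ a₁ := by
    by_contra hlt; push Not at hlt
    have := hmonoA t₁ ht₁ ha₁ (hmemA t₁ ht₁) hlt
    simp only at this; linarith [(haA t₁ ht₁).2]
  have hP1 : a₁ ≤ aP t₁ := by
    by_contra hlt; push Not at hlt
    have := hmonoP t₁ ht₁ (hmemP t₁ ht₁) ha₁ hlt
    simp only at this; linarith [(haP t₁ ht₁).2]
  -- at `t₂`: `aP t₂ ≤ a₂ ≤ aA t₂`
  have hA2 : a₂ ≤ aA t₂ := by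
    by_contra hlt; push Not at hlt
    have := hmonoA t₂ ht₂ (hmemA t₂ ht₂) ha₂ hlt
    simp only at this; linarith [(haA t₂ ht₂).2]
  have hP2 : aP t₂ ≤ a₂ := by
    by_contra hlt; push Not at hlt
    have := hmonoP t₂ ht₂ ha₂ (hmemP t₂ ht₂) hlt
    simp only at this; linarith [(haP t₂ ht₂).2]
  -- IVT for the continuous difference between `t₁` and `t₂`
  have hcont : ContinuousOn (fun t => aA t - aP t) (Set.uIcc t₁ t₂) := fun t ht =>
    ((continuousAt_isAlpha_selection hd hb hL J hc' hf hn₀ hpos hr0 haA (hpos_t t ht)).sub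
      (continuousAt_isAlphaPlus_selection hd hb hL J hij hc' hf hn₀ hpos hr0 haP (hpos_t t ht))).continuousWithinAt
  have h0 : (0 : ℝ) ∈ Set.uIcc (aA t₁ - aP t₁) (aA t₂ - aP t₂) := Set.mem_uIcc_of_le (by linarith) (by linarith)
  obtain ⟨t, ht, hzero⟩ := intermediate_value_uIcc hcont h0
  refine ⟨t, ht, aA t, haA t (hpos_t t ht), ?_⟩
  have heq : aA t = aP t := by simp only at hzero; linarith
  rw [heq]
  exact haP t (hpos_t t ht)

/-- The crossing criterion gives Ito–Seiler's Problem 2 on the instance (`Tomboulis2007.ISProblem2`). -/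
theorem isProblem2_holds_of_crossing (hd : 3 ≤ d) (hb : 2 ≤ b) (hL : Even L) (J : ℕ) {i j : Fin d} (hij : i < j) {c : ℕ → ℝ}
    (hc : CoeffAdmissible c) (hf : ∀ g : SU2, 0 ≤ plaqFn J c g) {n₀ : ℕ} (hn₀ : n₀ ∈ Icc 1 J) (hpos : 0 < c n₀) {r : ℝ}
    (hr0 : 0 ≤ r) (hr1 : r ≤ 1) {t₁ t₂ a₁ a₂ : ℝ} (ht₁ : 0 < t₁) (ht₂ : 0 < t₂) (ha₁ : a₁ ∈ Set.Ioc (0 : ℝ) 1)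
    (ha₂ : a₂ ∈ Set.Ioc (0 : ℝ) 1)
    (h1Z : torusZ d (b * L) J c ≤ tildeZ d L b J r c a₁ t₁)
    (h1P : tildeZplus L b J r i j hij c a₁ t₁ ≤ torusZplus d (b * L) J c (vortexSheet (b * L) i j hij))
    (h2Z : tildeZ d L b J r c a₂ t₂ ≤ torusZ d (b * L) J c)
    (h2P : torusZplus d (b * L) J c (vortexSheet (b * L) i j hij) ≤ tildeZplus L b J r i j hij c a₂ t₂) :
    ISProblem2 L b J r i j hij c := by
  obtain ⟨t, ht, α, hA, hP⟩ := isProblem2_of_crossing hd hb hL J hij hc hf hn₀ hpos hr0 hr1 ht₁ ht₂ ha₁ ha₂ h1Z h1P h2Z h2P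
  have ht0 : 0 < t := by
    rcases Set.mem_uIcc.1 ht with h | h
    · exact ht₁.trans_le h.1
    · exact ht₂.trans_le h.1
  exact ⟨t, ht0, α, hA, hP⟩

end Crossing

end Summit.Ventures.YMGap.Census

end
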